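import Mathlib
import Summits.NavierStokesRegularity.NavierStokesRegularity.Theorems.FilamentSkeletonRssStadiumFixedSourcePiece
import Summits.NavierStokesRegularity.NavierStokesRegularity.Theorems.FilamentSkeletonRssStadiumKernelPieces

/-!
# Route `FilamentSkeletonRss` · child crux `TangentSkeletonNearStraightL` (stmt-NavierStokesRegularity-23320) · registered line
# `child_tangent_analytic_strip_L` (b0b56c52900dd90a), stub `stub_stripPropagation` — brick for `rcore`: A FROZEN SLOPED SEGMENT PIECE IS HOLOMORPHIC AND `O(length)`

Toward the right-half quarter-width core `rcore` of `Theorems.StadiumStripPropagationRightHalf.stripPropagation_of_rightHalfCore` (the by-name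
closer of the stub; evidence `QUARTER-CONTOUR-CERTIFICATES-v2-leafhand-15-g1.md` on 23320).  The own-filament continued field is a sum of
integrals of the matched kernel over the pieces of a target-anchored tent; in the freeze step each piece is a FIXED straight segment `[p, q]` of
sources `γ(t) = p + t(q − p)` while the target `z` ranges over a small open set `V`.  For such a piece, with `F` holomorphic on an open `W ⊇ V`
containing the segment, `G` continuous on `W`, a UNIFORM margin `0 < μ ≤ Re(Σᵢ (Fᵢ z − Fᵢ(γ t))² + κ·G(γ t))` (the quantitative corner
certificates + `Theorems.StadiumChordPerturb`), `‖F′(γ t)‖ ≤ M` and `‖F z − F(γ t)‖ ≤ R₁`: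
* `segment_kernel_norm_le` — the integrand is bounded by `μ^{-3/2}·2·(‖q − p‖M)·R₁`;
* `segmentPiece_differentiableOn` — `z ↦ ∫_{t ∈ [0,1]} ((q−p)•F′(γ t)) ⨯₃-kernel dt` is holomorphic on `V` (`Theorems.StadiumFixedSourcePiece`);
* `segmentPiece_norm_le` — and bounded by `μ^{-3/2}·2·(‖q − p‖M)·R₁`.
HONEST FRAMING: a brick for a plan about a HYPOTHETICAL filament skeleton on the NEGATIVE side of a MODEL route; the stub `stub_stripPropagation` is NOT
closed by this file; nothing here bears on Navier–Stokes regularity or blow-up.  `--supports stmt-NavierStokesRegularity-23320`.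
-/

set_option linter.dupNamespace false

noncomputable section

namespace Summit.NavierStokesRegularity.NavierStokesRegularity.Theorems.StadiumSegmentPiece

open Set Filter Topology Complex MeasureTheory Metric
open scoped Matrix
open Summit.NavierStokesRegularity.NavierStokesRegularity.Theorems.StadiumFixedSourcePiece
open Summit.NavierStokesRegularity.NavierStokesRegularity.Theorems.StadiumKernelPieces

/-- **Pointwise bound of the matched kernel under a margin.**  If `0 < μ ≤ Re w`, `‖D‖ ≤ D₁`, `‖v‖ ≤ R₁` then
`‖(w^{3/2})⁻¹ • (D ⨯₃ v)‖ ≤ μ^{−3/2}·2·D₁·R₁`. [folklore] -/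
theorem segment_kernel_norm_le {w : ℂ} {D v : Fin 3 → ℂ} {μ D₁ R₁ : ℝ} (hμ : 0 < μ) (hw : μ ≤ w.re)
    (hD : ‖D‖ ≤ D₁) (hv : ‖v‖ ≤ R₁) :
    ‖(w ^ ((3:ℂ) / 2))⁻¹ • (D ⨯₃ v)‖ ≤ μ ^ (-(3/2 : ℝ)) * (2 * D₁ * R₁) := by
  have hwre : 0 < w.re := lt_of_lt_of_le hμ hw
  have h1 : ‖(w ^ ((3:ℂ) / 2))⁻¹‖ ≤ μ ^ (-(3/2 : ℝ)) :=
    (norm_inv_cpow_threeHalves_le hwre).trans (Real.rpow_le_rpow_of_nonpos hμ hw (by norm_num))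
  have h2 : ‖D ⨯₃ v‖ ≤ 2 * D₁ * R₁ := by
    have h := norm_crossProduct_le D v
    have hD0 : 0 ≤ D₁ := (norm_nonneg _).trans hD
    calc ‖D ⨯₃ v‖ ≤ 2 * ‖D‖ * ‖v‖ := h
      _ ≤ 2 * D₁ * R₁ := by
          have := mul_le_mul hD hv (norm_nonneg _) hD0
          linarith
  rw [norm_smul]
  exact mul_le_mul h1 h2 (norm_nonneg _) (Real.rpow_nonneg hμ.le _)

/-- **A frozen sloped segment piece is holomorphic in the target.**  `W` open, `F` holomorphic on `W`, `G` continuous on `W`; an open `V ⊆ W` of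
targets; a source segment `γ(t) = p + t(q − p)`, `t ∈ [0,1]`, inside `W`; a uniform margin `0 < μ ≤ Re(Σᵢ (Fᵢ z − Fᵢ(γ t))² + κ G(γ t))`,
`‖F′(γ t)‖ ≤ M`, `‖F z − F(γ t)‖ ≤ R₁` for `z ∈ V`, `t ∈ [0,1]`.  Then
`z ↦ ∫_{t∈[0,1]} ((Σᵢ (Fᵢ z − Fᵢ(γ t))² + κ G(γ t))^{3/2})⁻¹ • (((q−p)•F′(γ t)) ⨯₃ (F z − F(γ t))) dt` is holomorphic on `V`. [folklore] -/
theorem segmentPiece_differentiableOn {W V : Set ℂ} (hW : IsOpen W) (hV : IsOpen V) (hVW : V ⊆ W) {F : ℂ → (Fin 3 → ℂ)}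
    (hF : DifferentiableOn ℂ F W) {G : ℂ → ℂ} (hG : ContinuousOn G W) {p q : ℂ}
    (hseg : ∀ t : ℝ, p + (↑(max 0 (min t 1)) : ℂ) * (q - p) ∈ W) {κ μ M R₁ : ℝ} (hμ : 0 < μ)
    (hpos : ∀ z ∈ V, ∀ t ∈ Icc (0:ℝ) 1,
      μ ≤ ((∑ i, (F z i - F (p + (t : ℂ) * (q - p)) i) ^ 2) + (κ : ℂ) * G (p + (t : ℂ) * (q - p))).re)
    (hM : ∀ t ∈ Icc (0:ℝ) 1, ‖deriv F (p + (t : ℂ) * (q - p))‖ ≤ M)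
    (hR : ∀ z ∈ V, ∀ t ∈ Icc (0:ℝ) 1, ‖F z - F (p + (t : ℂ) * (q - p))‖ ≤ R₁) :
    DifferentiableOn ℂ (fun z => ∫ t in Icc (0:ℝ) 1,
      (((∑ i, (F z i - F (p + (t : ℂ) * (q - p)) i) ^ 2) + (κ : ℂ) * G (p + (t : ℂ) * (q - p))) ^ ((3:ℂ) / 2))⁻¹ •
        (((q - p) • deriv F (p + (t : ℂ) * (q - p))) ⨯₃ (fun i => F z i - F (p + (t : ℂ) * (q - p)) i))) V := by
  -- clamped (globally continuous) source data agreeing with the segment on `[0,1]`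
  set cl : ℝ → ℝ := fun t => max 0 (min t 1) with hcl
  have hcl_mem : ∀ t, cl t ∈ Icc (0:ℝ) 1 := fun t => ⟨le_max_left _ _, max_le zero_le_one (min_le_right _ _)⟩
  have hcl_eq : ∀ t ∈ Icc (0:ℝ) 1, cl t = t := fun t ht => by
    simp only [hcl]; rw [min_eq_left ht.2, max_eq_right ht.1]
  have hclc : Continuous cl := continuous_const.max (continuous_id.min continuous_const)
  set γ : ℝ → ℂ := fun t => p + ((cl t : ℝ) : ℂ) * (q - p) with hγ
  have hγc : Continuous γ := continuous_const.add ((Complex.continuous_ofReal.comp hclc).mul continuous_const)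
  have hγW : ∀ t, γ t ∈ W := fun t => hseg t
  have hFc : Continuous fun t => F (γ t) :=
    (hF.continuousOn.comp_continuous hγc hγW)
  have hF'c : Continuous fun t => deriv F (γ t) := by
    have hd : ContinuousOn (deriv F) W := (hF.analyticOnNhd hW).deriv.continuousOn
    exact hd.comp_continuous hγc hγW
  have hDc : Continuous fun t => (q - p) • deriv F (γ t) := hF'c.const_smul (q - p)
  have hGc : Continuous fun t => G (γ t) := hG.comp_continuous hγc hγW
  have hFV : DifferentiableOn ℂ F V := hF.mono hVW
  -- on `[0,1]` the clamped data are the segment data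
  have hγeq : ∀ t ∈ Icc (0:ℝ) 1, γ t = p + (t : ℂ) * (q - p) := fun t ht => by simp only [hγ, hcl_eq t ht]
  have hpos' : ∀ z ∈ V, ∀ t ∈ Icc (0:ℝ) 1, 0 < ((∑ i, (F z i - F (γ t) i) ^ 2) + (κ : ℂ) * G (γ t)).re := by
    intro z hz t ht; rw [hγeq t ht]; exact lt_of_lt_of_le hμ (hpos z hz t ht)
  have hdom : ∀ z ∈ V, ∀ t ∈ Icc (0:ℝ) 1,
      ‖(((∑ i, (F z i - F (γ t) i) ^ 2) + (κ : ℂ) * G (γ t)) ^ ((3:ℂ) / 2))⁻¹ •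
        (((q - p) • deriv F (γ t)) ⨯₃ (fun i => F z i - F (γ t) i))‖ ≤ μ ^ (-(3/2 : ℝ)) * (2 * (‖q - p‖ * M) * R₁) := by
    intro z hz t ht
    rw [hγeq t ht]
    refine segment_kernel_norm_le hμ (hpos z hz t ht) ?_ ?_
    · rw [norm_smul]; exact mul_le_mul_of_nonneg_left (hM t ht) (norm_nonneg _)
    · have h := hR z hz t ht
      have e : (fun i => F z i - F (p + (t : ℂ) * (q - p)) i) = F z - F (p + (t : ℂ) * (q - p)) := by
        funext i; simp
      rw [e]; exact h
  have h := differentiableOn_fixedSourcePiece hV hFV (P := fun t => F (γ t)) (D := fun t => (q - p) • deriv F (γ t))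
    (Gc := fun t => G (γ t)) hFc hDc hGc (κ := κ) (T := Icc (0:ℝ) 1) measurableSet_Icc hpos'
    (bound := fun _ => μ ^ (-(3/2 : ℝ)) * (2 * (‖q - p‖ * M) * R₁)) (by exact integrableOn_const (by simp)) hdom
  refine h.congr fun z hz => ?_
  refine setIntegral_congr_fun measurableSet_Icc fun t ht => ?_
  simp only [hγeq t ht]

/-- **… and `O(length)`**: under the same hypotheses, for `z ∈ V`,
`‖∫_{t∈[0,1]} …‖ ≤ μ^{−3/2}·2·(‖q − p‖M)·R₁`. [folklore] -/
theorem segmentPiece_norm_le {V : Set ℂ} {F : ℂ → (Fin 3 → ℂ)} {G : ℂ → ℂ} {p q : ℂ} {κ μ M R₁ : ℝ} (hμ : 0 < μ)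
    (hpos : ∀ z ∈ V, ∀ t ∈ Icc (0:ℝ) 1,
      μ ≤ ((∑ i, (F z i - F (p + (t : ℂ) * (q - p)) i) ^ 2) + (κ : ℂ) * G (p + (t : ℂ) * (q - p))).re)
    (hM : ∀ t ∈ Icc (0:ℝ) 1, ‖deriv F (p + (t : ℂ) * (q - p))‖ ≤ M)
    (hR : ∀ z ∈ V, ∀ t ∈ Icc (0:ℝ) 1, ‖F z - F (p + (t : ℂ) * (q - p))‖ ≤ R₁) {z : ℂ} (hz : z ∈ V) :
    ‖∫ t in Icc (0:ℝ) 1,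
      (((∑ i, (F z i - F (p + (t : ℂ) * (q - p)) i) ^ 2) + (κ : ℂ) * G (p + (t : ℂ) * (q - p))) ^ ((3:ℂ) / 2))⁻¹ •
        (((q - p) • deriv F (p + (t : ℂ) * (q - p))) ⨯₃ (fun i => F z i - F (p + (t : ℂ) * (q - p)) i))‖ ≤
      μ ^ (-(3/2 : ℝ)) * (2 * (‖q - p‖ * M) * R₁) := by
  have hdom : ∀ t ∈ Icc (0:ℝ) 1,
      ‖(((∑ i, (F z i - F (p + (t : ℂ) * (q - p)) i) ^ 2) + (κ : ℂ) * G (p + (t : ℂ) * (q - p))) ^ ((3:ℂ) / 2))⁻¹ •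
        (((q - p) • deriv F (p + (t : ℂ) * (q - p))) ⨯₃ (fun i => F z i - F (p + (t : ℂ) * (q - p)) i))‖ ≤
        μ ^ (-(3/2 : ℝ)) * (2 * (‖q - p‖ * M) * R₁) := by
    intro t ht
    refine segment_kernel_norm_le hμ (hpos z hz t ht) ?_ ?_
    · rw [norm_smul]; exact mul_le_mul_of_nonneg_left (hM t ht) (norm_nonneg _)
    · have h := hR z hz t ht
      have e : (fun i => F z i - F (p + (t : ℂ) * (q - p)) i) = F z - F (p + (t : ℂ) * (q - p)) := by
        funext i; simp
      rw [e]; exact h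
  have h := norm_setIntegral_le_of_norm_le_const (μ := volume) (s := Icc (0:ℝ) 1) (by simp) hdom
  simpa using h

end Summit.NavierStokesRegularity.NavierStokesRegularity.Theorems.StadiumSegmentPiece

end
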